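/-
Copyright (c) 2026 the pub-hodgecm-mathlib formalisation cell (harness21).  Prover seat hodgecm-mathlib-K2E1-p09 (g5), Track B ∕ K2-LIT,
h413 = `stmt-HodgeConjecture-24833`, line `K2_E1_TraceFormulaBeta`, page «EIS-RANK-ONE», deal [D1] of the dealer K2E1-plan (g3) 2026-09-04T05:34:55Z, part (D1-c)
PART II (re-route 05:55:36Z, name of record `K2E1FlatSectionLineRestrictionArchU2`): the ARCHIMEDEAN half — from `C^m` smoothness of the big-cell section along the
archimedean line with an integrable envelope to the fibrewise Fourier-decay binder (`hA`, `hdecArch`) of ★ (D1-d) edition A, through ★ p857740.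
-/
import Summits.HodgeConjecture.HodgeConjecture.Theorems.K2E1FlatSectionLineRestrictionU2    -- ★ (D1-c) I: line algebra, ONE level `𝔫` for a compact `K`
import Summits.HodgeConjecture.HodgeConjecture.Theorems.K2E1InfiniteAdeleFourierDecay        -- ★ p857740 (K2E4-p10 (g3)): `C^n` + `L¹` derivatives ⟹ archimedean Fourier decay
import Summits.HodgeConjecture.HodgeConjecture.Theorems.K2E1AdelicFourierEnvelope           -- ★ p857712: `μ = c·(μ₁ ⊗ μ₂)`, `integrable_iff_integrable_prod`
import HarnessLib

/-!
# h413 ∕ Track B «K2-LIT», «EIS-RANK-ONE» R6d₂ (D1-c) PART II — `K2E1FlatSectionLineRestrictionArchU2`: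
# archimedean `C^m` smoothness of `s ↦ f(ι(w₀)·n(θ(ι⁻¹s, b))·k)` with an integrable envelope ⟹ the fibrewise decay binder of ★ p857712 ∕ ★ (D1-d), uniformly on `K`

Cell `pub/hodgecm-mathlib`, crux H413 = `stmt-HodgeConjecture-24833`, route `HCCMUnconditional`; dealer K2E1-plan (g3), deal [D1] 05:34:55Z, rulings «R6d-FIBREWISE»
05:44:38Z (the archimedean input is ONE named binder `hφarch` in `ContDiff`-along-the-line currency) and 05:55:36Z (this file's name).  THEOREMS ONLY (no `def`, no `instance`, no
`notation`, no named-fact hypothesis, no `sorry`); lane `--kind proof --supports stmt-HodgeConjecture-24833 --as helper` (count-neutral).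

THE STATEMENT (`U(J₂)`, any quadratic `(F, E, c)`, any `f : G(𝔸) → ℂ`, a compact `K ⊆ G(𝔸)`, an open subgroup `U ≤ G(𝔸)`).  Write `Φ_k(a, b) = f(ι(w₀)·n(θ(a, b))·k)` and
`g_{k,b} = Φ_k(·, b) ∘ ι⁻¹ : (F ⊗ ℝ) → ℂ` (`ι = InfiniteAdeleRing.ringEquiv_mixedSpace F`).  SUPPOSE (`hφarch`, the archimedean binder of ruling (2)): for every `k ∈ K` and
`b ∈ 𝔸_F^∞`, `g_{k,b}` is `C^m` and `‖D^j g_{k,b}(s)‖ ≤ 𝓔(ι(w₀)·n(θ(ι⁻¹ s, b))·k)` for `j ≤ m`, for an ENVELOPE `𝓔 : G(𝔸) → ℝ` which is right-`U`-invariant and integrable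
along the line uniformly on `K` (`∫_{𝔸_F} 𝓔(ι(w₀)·n(θ t)·k) dμ(t) ≤ N`) — nothing else is asked of `f` or `𝓔`.  THEN there are majorants `A k : 𝔸_F^∞ → ℝ` with `Integrable (A k) μ₂`,
`∫ A k dμ₂ ≤ N₂` (one `N₂ ≥ 0` for all `k ∈ K`) and `‖∫ Φ_k(a, b)·ψ_∞(y a) dμ₁(a)‖ ≤ A k b · (1 + ‖ι y‖)^{−m}` for ALL `k ∈ K`, `b`, `y` — i.e. exactly the binder
(`hN₂`, `hA`, `hdecArch`) of ★ (D1-d) `exists_bound_sub_borelConstantTerm_cm_two`.  For flat sections `𝓔 = C_φ·H^σ` ([D5] supplies `hφarch`; ★ (D1-c) I + ★ R2 supply the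
line integrability, edition B of (D1-d)).

THE PROOF.  ★ p857740 `exists_forall_norm_integral_mul_adeleAddChar_le` gives the fibre bound with `A k b := C·Σ_{j ≤ m} ‖D^j g_{k,b}‖₁` as soon as every `D^j g_{k,b}` is
`L¹(ι_* μ₁)`; the envelope makes `‖D^j g_{k,b}‖₁ ≤ ∫ 𝓔(ι(w₀)·n(θ(a,b))·k) dμ₁(a) =: e_k(b)` PROVIDED the fibre `a ↦ 𝓔(…(a, b)…)` is integrable — for EVERY `b`, not only
almost every: this is §1's coset lemma (Tonelli gives a.e. `b`; the fibre is PERIODIC in `b` under the OPEN subgroup `𝔫𝒪̂_F` of ★ (D1-c) I's tube lemma, and an additive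
Haar measure charges open cosets, so the exceptional null set is empty).  Finally `A k := C(m+1)·e_k` is integrable with `∫ A k dμ₂ = C(m+1)·c⁻¹·∫_{𝔸_F} 𝓔 ≤ N₂` by
Fubini and ★ p857712 (F1) (`μ = c·(μ₁ ⊗ μ₂)`).

* §1 `integrable_fibre_of_periodic` (every fibre of an integrable, `S`-periodic function is integrable when `S` is an open subgroup), `integral_ofReal_adele_prod` (real reading of
  ★ (F1)).
* §2 `norm_integral_fibre_le_of_contDiff` — ONE `(k, b)`: `C^m` + pointwise envelope + integrable envelope fibre ⟹ ★ p857740's bound with `A = C·(m+1)·∫ 𝓔`.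
* §3 **`exists_fibre_majorant_of_archSmooth`** — THE HEAD: (`hN₂`, `hA`, `hdecArch`) of ★ (D1-d) from `hφarch` + the envelope's line integrability, uniformly on the compact `K`.

HONEST LABEL.  Count-neutral helper; proves no printed statement; HC_CM is proved only modulo the 7 printed citations (2 remaining named inputs: hLiu418 =
`stmt-HodgeConjecture-24832`, h413 = `stmt-HodgeConjecture-24833`) until rung 0 closes.  `hφarch` is NOT discharged here ([D5]).

## References
* [MoeglinWaldspurger1995] C. Mœglin, J.-L. Waldspurger, *Spectral decomposition and Eisenstein series* (1995), I.2.10–I.2.12, II.1.7 (rapid decay of `E − E_P` from smoothness).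
* [Garrett2018] P. Garrett, *Modern Analysis of Automorphic Forms by Example* 1 (2018), §2.9, §12.2 (archimedean integration by parts against the character).
* [CasselsFrohlichANT1967] J. Tate, *Fourier analysis in number fields and Hecke's zeta-functions*, Ch. XV §3.3, §4.2 (`dx = ∏ dx_v`, Poisson).
-/

set_option autoImplicit false
set_option linter.dupNamespace false  -- the mandated namespace repeats the summit's segment (`HodgeConjecture.HodgeConjecture`)

noncomputable section

open MeasureTheory Measure Filter Topology NumberField NumberField.mixedEmbedding IsDedekindDomain MulAction Module
open Literature.NumberTheory.Automorphic Literature.NumberTheory.Automorphic.UnitaryGroup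
open Summit.HodgeConjecture.HodgeConjecture.Cruxes.H413.K2E1FlatSectionLineRestrictionU2
open Summit.HodgeConjecture.HodgeConjecture.Cruxes.H413.K2E1InfiniteAdeleFourierDecay
open Summit.HodgeConjecture.HodgeConjecture.Cruxes.H413.K2E1AdelicFourierEnvelope
-- `Classical` is needed to see the Mathlib normed-space instances on `mixedSpace` (note H5 of `AdelicGLnGlue`)
open scoped ENNReal NNReal Classical Pointwise

namespace Summit.HodgeConjecture.HodgeConjecture.Cruxes.H413.K2E1FlatSectionLineRestrictionArchU2

/-! ## §1 Every fibre of an integrable periodic function is integrable; the real reading of `μ = c·(μ₁ ⊗ μ₂)` -/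

section Fibre

variable (F : Type) [Field F] [NumberField F]
  [MeasurableSpace (AdeleRing (𝓞 F) F)] [BorelSpace (AdeleRing (𝓞 F) F)]
  [MeasurableSpace (InfiniteAdeleRing F)] [BorelSpace (InfiniteAdeleRing F)]
  [MeasurableSpace (FiniteAdeleRing (𝓞 F) F)] [BorelSpace (FiniteAdeleRing (𝓞 F) F)]

omit [MeasurableSpace (AdeleRing (𝓞 F) F)] [BorelSpace (AdeleRing (𝓞 F) F)] [BorelSpace (InfiniteAdeleRing F)] [BorelSpace (FiniteAdeleRing (𝓞 F) F)] in
/-- **Every fibre of an integrable, level-periodic function on `F_∞ × 𝔸_F^∞` is integrable.**  If `e ∈ L¹(μ₁ ⊗ μ₂)` and `e(a, b + l) = e(a, b)` for `l` in the level subgroup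
`𝔫𝒪̂_F` (OPEN, ★ `isOpen_levelIdeal`), then `a ↦ e(a, b)` is `μ₁`-integrable for EVERY `b`: Tonelli gives almost every `b`, the exceptional set is a union of cosets of
`𝔫𝒪̂_F`, and the additive Haar measure `μ₂` charges open sets. [cite: CasselsFrohlichANT1967, Ch. XV §3.3] -/
theorem integrable_fibre_of_periodic (μ₁ : Measure (InfiniteAdeleRing F)) [SFinite μ₁] (μ₂ : Measure (FiniteAdeleRing (𝓞 F) F)) [μ₂.IsAddHaarMeasure] [SFinite μ₂]
    {V : Type*} [NormedAddCommGroup V] {e : InfiniteAdeleRing F × FiniteAdeleRing (𝓞 F) F → V} (he : Integrable e (μ₁.prod μ₂)) (𝔫 : Ideal (𝓞 F))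
    (hper : ∀ (a : InfiniteAdeleRing F) (b : FiniteAdeleRing (𝓞 F) F), ∀ l ∈ levelIdeal F 𝔫, e (a, b + l) = e (a, b)) (b : FiniteAdeleRing (𝓞 F) F) :
    Integrable (fun a => e (a, b)) μ₁ := by
  by_contra hb
  have hae := he.prod_left_ae
  rw [ae_iff] at hae
  -- the whole coset `b + 𝔫𝒪̂_F` is exceptional
  have hsub : {b} + (levelIdeal F 𝔫 : Set (FiniteAdeleRing (𝓞 F) F)) ⊆ {b' | ¬Integrable (fun a => e (a, b')) μ₁} := by
    rintro _ ⟨b₀, hb₀, l, hl, rfl⟩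
    rw [Set.mem_singleton_iff] at hb₀
    subst hb₀
    have hfun : (fun a => e (a, b₀ + l)) = fun a => e (a, b₀) := funext fun a => hper a b₀ l hl
    show ¬Integrable (fun a => e (a, b₀ + l)) μ₁
    rw [hfun]
    exact hb
  have hopen : IsOpen ({b} + (levelIdeal F 𝔫 : Set (FiniteAdeleRing (𝓞 F) F))) := (isOpen_levelIdeal 𝔫).add_left
  have hpos := hopen.measure_pos μ₂ ⟨b + 0, Set.add_mem_add (Set.mem_singleton b) (levelIdeal F 𝔫).zero_mem⟩
  exact absurd (measure_mono_null hsub hae) hpos.ne'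

omit [BorelSpace (AdeleRing (𝓞 F) F)] [BorelSpace (InfiniteAdeleRing F)] [BorelSpace (FiniteAdeleRing (𝓞 F) F)] in
/-- **The real reading of `μ = c·(μ₁ ⊗ μ₂)`** (★ p857712 (F1) is typed for `ℂ`-valued integrands): `∫_𝔸 G dμ = c·∫∫ G(a,b) dμ₁ dμ₂` for `G : 𝔸_F → ℝ`.
[cite: CasselsFrohlichANT1967, Ch. XV §3.3] -/
theorem integral_real_adele_eq_mul_integral_prod {μ : Measure (AdeleRing (𝓞 F) F)} {μ₁ : Measure (InfiniteAdeleRing F)} {μ₂ : Measure (FiniteAdeleRing (𝓞 F) F)} {c₀ : ℝ≥0}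
    (hc : ∀ G : InfiniteAdeleRing F → FiniteAdeleRing (𝓞 F) F → ℂ,
      ∫ v, G v.1 v.2 ∂μ = (c₀ : ℝ) • ∫ p : InfiniteAdeleRing F × FiniteAdeleRing (𝓞 F) F, G p.1 p.2 ∂(μ₁.prod μ₂))
    (G : AdeleRing (𝓞 F) F → ℝ) :
    ∫ v, G v ∂μ = (c₀ : ℝ) * ∫ p : InfiniteAdeleRing F × FiniteAdeleRing (𝓞 F) F, G (p.1, p.2) ∂(μ₁.prod μ₂) := by
  have h := hc fun a b => ((G (a, b) : ℝ) : ℂ)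
  beta_reduce at h
  have e1 : ∫ v, ((G (v.1, v.2) : ℝ) : ℂ) ∂μ = ((∫ v, G v ∂μ : ℝ) : ℂ) := integral_ofReal
  have e2 : ∫ p : InfiniteAdeleRing F × FiniteAdeleRing (𝓞 F) F, ((G (p.1, p.2) : ℝ) : ℂ) ∂(μ₁.prod μ₂) =
      ((∫ p : InfiniteAdeleRing F × FiniteAdeleRing (𝓞 F) F, G (p.1, p.2) ∂(μ₁.prod μ₂) : ℝ) : ℂ) := integral_ofReal
  rw [e1, e2, Complex.real_smul, ← Complex.ofReal_mul] at h
  exact_mod_cast h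

end Fibre

/-! ## §2 One fibre: `C^m` + envelope ⟹ the bound of ★ p857740 with `A = C·(m+1)·∫ 𝓔` -/

section OneFibre

variable (F : Type) [Field F] [NumberField F] [MeasurableSpace (InfiniteAdeleRing F)] [BorelSpace (InfiniteAdeleRing F)]

/-- **ONE FIBRE.**  Let `C` be the constant of ★ `exists_forall_norm_integral_mul_adeleAddChar_le μ₁ m` (in the displayed shape `hC`).  If `Φ₁ ∘ ι⁻¹` is `C^m` with
`‖D^j(Φ₁ ∘ ι⁻¹)(s)‖ ≤ e(ι⁻¹ s)` (`j ≤ m`) for a `μ₁`-INTEGRABLE `e`, then `‖∫ Φ₁(a)·ψ_∞(y a) dμ₁(a)‖ ≤ (C·((m+1)·∫ e dμ₁))·(1 + ‖ι y‖)^{−m}` (domination makes every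
`D^j` integrable; `‖D^j‖₁ ≤ ∫ e` by monotonicity; change of variables along the measurable equivalence `ι`). [cite: Garrett2018, §12.2] [cite: MoeglinWaldspurger1995, I.2.10] -/
theorem norm_integral_fibre_le_of_contDiff (μ₁ : Measure (InfiniteAdeleRing F)) {m : ℕ} {C : ℝ} (hC0 : 0 ≤ C)
    (hC : ∀ Φ₁ : InfiniteAdeleRing F → ℂ,
      ContDiff ℝ m (Φ₁ ∘ (InfiniteAdeleRing.ringEquiv_mixedSpace F).symm) →
      (∀ j : ℕ, j ≤ m → Integrable (iteratedFDeriv ℝ j (Φ₁ ∘ (InfiniteAdeleRing.ringEquiv_mixedSpace F).symm)) (μ₁.map (InfiniteAdeleRing.ringEquiv_mixedSpace F))) →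
      ∀ y : InfiniteAdeleRing F,
        ‖∫ a, Φ₁ a * (adeleAddChar F (infiniteAdeleInl F (y * a)) : ℂ) ∂μ₁‖ ≤
          (C * ∑ j ∈ Finset.range (m + 1), ∫ x, ‖iteratedFDeriv ℝ j (Φ₁ ∘ (InfiniteAdeleRing.ringEquiv_mixedSpace F).symm) x‖ ∂(μ₁.map (InfiniteAdeleRing.ringEquiv_mixedSpace F))) *
            (1 + ‖InfiniteAdeleRing.ringEquiv_mixedSpace F y‖) ^ (-(m : ℝ)))
    {Φ₁ : InfiniteAdeleRing F → ℂ} (hΦ : ContDiff ℝ m (Φ₁ ∘ (InfiniteAdeleRing.ringEquiv_mixedSpace F).symm))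
    {e : InfiniteAdeleRing F → ℝ} (hei : Integrable e μ₁)
    (henv : ∀ j : ℕ, j ≤ m → ∀ s : mixedSpace F,
      ‖iteratedFDeriv ℝ j (Φ₁ ∘ (InfiniteAdeleRing.ringEquiv_mixedSpace F).symm) s‖ ≤ e ((InfiniteAdeleRing.ringEquiv_mixedSpace F).symm s))
    (y : InfiniteAdeleRing F) :
    ‖∫ a, Φ₁ a * (adeleAddChar F (infiniteAdeleInl F (y * a)) : ℂ) ∂μ₁‖ ≤
      (C * (((m : ℝ) + 1) * ∫ a, e a ∂μ₁)) * (1 + ‖InfiniteAdeleRing.ringEquiv_mixedSpace F y‖) ^ (-(m : ℝ)) := by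
  have hme : MeasurableEmbedding (InfiniteAdeleRing.ringEquiv_mixedSpace F) := by
    rw [← coe_infiniteAdeleRingHomeomorph]
    exact (infiniteAdeleRingHomeomorph F).measurableEmbedding
  -- the envelope along `ι`: `e ∘ ι⁻¹` is `ι_* μ₁`-integrable with the same integral
  have hcomp : (fun s : mixedSpace F => e ((InfiniteAdeleRing.ringEquiv_mixedSpace F).symm s)) ∘ (InfiniteAdeleRing.ringEquiv_mixedSpace F) = e := by
    funext a; simp only [Function.comp_apply, RingEquiv.symm_apply_apply]
  have hei' : Integrable (fun s : mixedSpace F => e ((InfiniteAdeleRing.ringEquiv_mixedSpace F).symm s)) (μ₁.map (InfiniteAdeleRing.ringEquiv_mixedSpace F)) := by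
    rw [hme.integrable_map_iff, hcomp]; exact hei
  have hint : ∫ s, e ((InfiniteAdeleRing.ringEquiv_mixedSpace F).symm s) ∂(μ₁.map (InfiniteAdeleRing.ringEquiv_mixedSpace F)) = ∫ a, e a ∂μ₁ := by
    rw [hme.integral_map]; simp only [RingEquiv.symm_apply_apply]
  -- every derivative up to order `m` is integrable (continuous, dominated by the envelope)
  have hDi : ∀ j : ℕ, j ≤ m → Integrable (iteratedFDeriv ℝ j (Φ₁ ∘ (InfiniteAdeleRing.ringEquiv_mixedSpace F).symm)) (μ₁.map (InfiniteAdeleRing.ringEquiv_mixedSpace F)) :=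
    fun j hj => hei'.mono' ((hΦ.of_le (by exact_mod_cast hj)).continuous_iteratedFDeriv'.aestronglyMeasurable) (Eventually.of_forall (henv j hj))
  -- `‖D^j‖₁ ≤ ∫ e`
  have hDle : ∀ j ∈ Finset.range (m + 1),
      ∫ x, ‖iteratedFDeriv ℝ j (Φ₁ ∘ (InfiniteAdeleRing.ringEquiv_mixedSpace F).symm) x‖ ∂(μ₁.map (InfiniteAdeleRing.ringEquiv_mixedSpace F)) ≤ ∫ a, e a ∂μ₁ := by
    intro j hj
    rw [← hint]
    exact integral_mono_of_nonneg (Eventually.of_forall fun _ => norm_nonneg _) hei' (Eventually.of_forall (henv j (Nat.lt_succ_iff.1 (Finset.mem_range.1 hj))))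
  have hsum : ∑ j ∈ Finset.range (m + 1), ∫ x, ‖iteratedFDeriv ℝ j (Φ₁ ∘ (InfiniteAdeleRing.ringEquiv_mixedSpace F).symm) x‖ ∂(μ₁.map (InfiniteAdeleRing.ringEquiv_mixedSpace F)) ≤
      ((m : ℝ) + 1) * ∫ a, e a ∂μ₁ := by
    refine (Finset.sum_le_sum hDle).trans (le_of_eq ?_)
    rw [Finset.sum_const, Finset.card_range, nsmul_eq_mul, Nat.cast_add, Nat.cast_one]
  refine (hC Φ₁ hΦ hDi y).trans (mul_le_mul_of_nonneg_right (mul_le_mul_of_nonneg_left hsum hC0) (Real.rpow_nonneg (by positivity) _))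

end OneFibre

/-! ## §3 The head: the fibrewise binder of ★ (D1-d), uniformly on a compact `K` -/

section Head

variable {F E : Type} [Field F] [NumberField F] [Field E] [NumberField E] [Algebra F E] [Algebra.IsQuadraticExtension F E] {c : E ≃ₐ[F] E}
  (hij : (((0 : Fin 2) : ℕ)) + 1 = ((1 : Fin 2) : ℕ)) (hN : 2 = 2 * ((0 : Fin 2) : ℕ) + 2) {δ : E}
  [MeasurableSpace (AdeleRing (𝓞 F) F)] [BorelSpace (AdeleRing (𝓞 F) F)]
  [MeasurableSpace (InfiniteAdeleRing F)] [BorelSpace (InfiniteAdeleRing F)]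
  [MeasurableSpace (FiniteAdeleRing (𝓞 F) F)] [BorelSpace (FiniteAdeleRing (𝓞 F) F)]

/-- **THE FIBREWISE ARCHIMEDEAN BINDER FROM `C^m` SMOOTHNESS ALONG THE LINE** (see the module docstring).  Inputs: a compact `K`, an open subgroup `U`, `f` and the envelope `𝓔` right-
`U`-invariant, `𝓔 ≥ 0` continuous and integrable along the line with `∫ 𝓔(ι(w₀)·n(θ t)·k) dμ(t) ≤ N` for `k ∈ K`, and `hφarch`.  Output: the triple (`hN₂`, `hA`, `hdecArch`) consumed by
★ `K2E1EisensteinMinusConstantTermBoundedCMTwo.exists_bound_sub_borelConstantTerm_cm_two`. [cite: MoeglinWaldspurger1995, I.2.10–I.2.12] [cite: Garrett2018, §2.9, §12.2] -/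
theorem exists_fibre_majorant_of_archSmooth (hcδ : c δ = -δ) (hδ : δ ≠ 0)
    (μ : Measure (AdeleRing (𝓞 F) F)) [μ.IsAddHaarMeasure]
    (μ₁ : Measure (InfiniteAdeleRing F)) [μ₁.IsAddHaarMeasure] (μ₂ : Measure (FiniteAdeleRing (𝓞 F) F)) [μ₂.IsAddHaarMeasure]
    {K : Set (quasiSplit F E c 2).Adelic} (hK : IsCompact K) {U : Subgroup (quasiSplit F E c 2).Adelic} (hUo : IsOpen (U : Set (quasiSplit F E c 2).Adelic))
    {f : (quasiSplit F E c 2).Adelic → ℂ}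
    {𝓔 : (quasiSplit F E c 2).Adelic → ℝ} (h𝓔U : ∀ u ∈ U, ∀ y : (quasiSplit F E c 2).Adelic, 𝓔 (y * u) = 𝓔 y)
    {N : ℝ} (h𝓔i : ∀ k ∈ K, Integrable (fun t : AdeleRing (𝓞 F) F => 𝓔 (((quasiSplit F E c 2).toAdelic (weylLongU (c : E →+* E) (rfl : ((StdForm.antidiagonal 2).over E) = ((StdForm.antidiagonal 2).over E)))) *
          ((middleRootUnipotent hij hN (Multiplicative.ofAdd (traceZeroLine F E c hcδ hδ t)) : ↥(adelicUnipotent F E c 2)) : (quasiSplit F E c 2).Adelic) * k)) μ)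
    (h𝓔N : ∀ k ∈ K, ∫ t, 𝓔 (((quasiSplit F E c 2).toAdelic (weylLongU (c : E →+* E) (rfl : ((StdForm.antidiagonal 2).over E) = ((StdForm.antidiagonal 2).over E)))) *
          ((middleRootUnipotent hij hN (Multiplicative.ofAdd (traceZeroLine F E c hcδ hδ t)) : ↥(adelicUnipotent F E c 2)) : (quasiSplit F E c 2).Adelic) * k) ∂μ ≤ N)
    {m : ℕ}
    (hφarch : ∀ k ∈ K, ∀ b : FiniteAdeleRing (𝓞 F) F,
      ContDiff ℝ m ((fun a : InfiniteAdeleRing F => f (((quasiSplit F E c 2).toAdelic (weylLongU (c : E →+* E) (rfl : ((StdForm.antidiagonal 2).over E) = ((StdForm.antidiagonal 2).over E)))) *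
          ((middleRootUnipotent hij hN (Multiplicative.ofAdd (traceZeroLine F E c hcδ hδ ((a, b) : AdeleRing (𝓞 F) F))) : ↥(adelicUnipotent F E c 2)) : (quasiSplit F E c 2).Adelic) * k)) ∘ (InfiniteAdeleRing.ringEquiv_mixedSpace F).symm) ∧
      ∀ j : ℕ, j ≤ m → ∀ s : mixedSpace F,
        ‖iteratedFDeriv ℝ j ((fun a : InfiniteAdeleRing F => f (((quasiSplit F E c 2).toAdelic (weylLongU (c : E →+* E) (rfl : ((StdForm.antidiagonal 2).over E) = ((StdForm.antidiagonal 2).over E)))) *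
          ((middleRootUnipotent hij hN (Multiplicative.ofAdd (traceZeroLine F E c hcδ hδ ((a, b) : AdeleRing (𝓞 F) F))) : ↥(adelicUnipotent F E c 2)) : (quasiSplit F E c 2).Adelic) * k)) ∘ (InfiniteAdeleRing.ringEquiv_mixedSpace F).symm) s‖ ≤
          𝓔 (((quasiSplit F E c 2).toAdelic (weylLongU (c : E →+* E) (rfl : ((StdForm.antidiagonal 2).over E) = ((StdForm.antidiagonal 2).over E)))) *
          ((middleRootUnipotent hij hN (Multiplicative.ofAdd (traceZeroLine F E c hcδ hδ ((((InfiniteAdeleRing.ringEquiv_mixedSpace F).symm s), b) : AdeleRing (𝓞 F) F))) : ↥(adelicUnipotent F E c 2)) : (quasiSplit F E c 2).Adelic) * k)) :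
    ∃ (A : (quasiSplit F E c 2).Adelic → FiniteAdeleRing (𝓞 F) F → ℝ) (N₂ : ℝ), 0 ≤ N₂ ∧
      (∀ k ∈ K, Integrable (A k) μ₂ ∧ ∫ b, A k b ∂μ₂ ≤ N₂) ∧
      ∀ k ∈ K, ∀ (b : FiniteAdeleRing (𝓞 F) F) (y : InfiniteAdeleRing F),
        ‖∫ a, f (((quasiSplit F E c 2).toAdelic (weylLongU (c : E →+* E) (rfl : ((StdForm.antidiagonal 2).over E) = ((StdForm.antidiagonal 2).over E)))) *
          ((middleRootUnipotent hij hN (Multiplicative.ofAdd (traceZeroLine F E c hcδ hδ ((a, b) : AdeleRing (𝓞 F) F))) : ↥(adelicUnipotent F E c 2)) : (quasiSplit F E c 2).Adelic) * k) *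
          (adeleAddChar F (infiniteAdeleInl F (y * a)) : ℂ) ∂μ₁‖ ≤ A k b * (1 + ‖InfiniteAdeleRing.ringEquiv_mixedSpace F y‖) ^ (-(m : ℝ)) := by
  haveI := secondCountableTopology_infiniteAdeleRing F
  haveI := secondCountableTopology_finiteAdeleRing F
  haveI := locallyCompactSpace_finiteAdeleRing' F
  -- the constant of ★ p857740 and the product constant of ★ p857712 (F1)
  obtain ⟨C, hC0, hC⟩ := exists_forall_norm_integral_mul_adeleAddChar_le F μ₁ m
  obtain ⟨c₀, hc₀, hc⟩ := exists_integral_adele_eq_smul_integral_prod F μ μ₁ μ₂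
  -- ONE level `𝔫` making the envelope fibres periodic for all `k ∈ K` (★ (D1-c) I)
  obtain ⟨𝔫, -, hper⟩ := exists_levelIdeal_forall_line_periodic_two' hij hN hcδ hδ hK hUo h𝓔U
  -- the envelope along the line, fibred: `e k (a, b)`
  set e : (quasiSplit F E c 2).Adelic → InfiniteAdeleRing F × FiniteAdeleRing (𝓞 F) F → ℝ := fun k p =>
    𝓔 (((quasiSplit F E c 2).toAdelic (weylLongU (c : E →+* E) (rfl : ((StdForm.antidiagonal 2).over E) = ((StdForm.antidiagonal 2).over E)))) *
          ((middleRootUnipotent hij hN (Multiplicative.ofAdd (traceZeroLine F E c hcδ hδ ((p.1, p.2) : AdeleRing (𝓞 F) F))) : ↥(adelicUnipotent F E c 2)) : (quasiSplit F E c 2).Adelic) * k) with he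
  have hei : ∀ k ∈ K, Integrable (e k) (μ₁.prod μ₂) := fun k hk => by
    have h := (integrable_iff_integrable_prod F μ μ₁ μ₂ (fun t : AdeleRing (𝓞 F) F => ((𝓔 (((quasiSplit F E c 2).toAdelic (weylLongU (c : E →+* E) (rfl : ((StdForm.antidiagonal 2).over E) = ((StdForm.antidiagonal 2).over E)))) *
          ((middleRootUnipotent hij hN (Multiplicative.ofAdd (traceZeroLine F E c hcδ hδ t)) : ↥(adelicUnipotent F E c 2)) : (quasiSplit F E c 2).Adelic) * k) : ℝ) : ℂ))).1
      ((h𝓔i k hk).ofReal)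
    exact (h.re).congr (Eventually.of_forall fun p => by simp only [he, RCLike.re_to_complex, Complex.ofReal_re])
  -- every fibre is integrable (§1)
  have hfib : ∀ k ∈ K, ∀ b : FiniteAdeleRing (𝓞 F) F, Integrable (fun a => e k (a, b)) μ₁ := fun k hk b =>
    integrable_fibre_of_periodic F μ₁ μ₂ (hei k hk) 𝔫 (fun a b' l hl => by simp only [he]; exact hper k hk a b' l hl) b
  -- the majorants
  refine ⟨fun k b => C * (((m : ℝ) + 1) * ∫ a, e k (a, b) ∂μ₁), C * (((m : ℝ) + 1) * ((c₀ : ℝ)⁻¹ * max N 0)), ?_, fun k hk => ⟨?_, ?_⟩, fun k hk b y => ?_⟩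
  · -- `0 ≤ N₂`
    exact mul_nonneg hC0 (mul_nonneg (by positivity) (mul_nonneg (inv_nonneg.2 (NNReal.coe_nonneg c₀)) (le_max_right _ _)))
  · -- `Integrable (A k) μ₂`
    exact ((hei k hk).integral_prod_right.const_mul ((m : ℝ) + 1)).const_mul C
  · -- `∫ A k dμ₂ ≤ N₂`
    rw [integral_const_mul, integral_const_mul]
    refine mul_le_mul_of_nonneg_left (mul_le_mul_of_nonneg_left ?_ (by positivity)) hC0
    rw [← integral_prod_symm (e k) (hei k hk)]
    have hreal := integral_real_adele_eq_mul_integral_prod F hc (fun t : AdeleRing (𝓞 F) F => 𝓔 (((quasiSplit F E c 2).toAdelic (weylLongU (c : E →+* E) (rfl : ((StdForm.antidiagonal 2).over E) = ((StdForm.antidiagonal 2).over E)))) *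
          ((middleRootUnipotent hij hN (Multiplicative.ofAdd (traceZeroLine F E c hcδ hδ t)) : ↥(adelicUnipotent F E c 2)) : (quasiSplit F E c 2).Adelic) * k))
    have hc₀' : (c₀ : ℝ) ≠ 0 := (NNReal.coe_pos.2 hc₀).ne'
    have heq : ∫ p, e k p ∂(μ₁.prod μ₂) = (c₀ : ℝ)⁻¹ * ∫ t, 𝓔 (((quasiSplit F E c 2).toAdelic (weylLongU (c : E →+* E) (rfl : ((StdForm.antidiagonal 2).over E) = ((StdForm.antidiagonal 2).over E)))) *
          ((middleRootUnipotent hij hN (Multiplicative.ofAdd (traceZeroLine F E c hcδ hδ t)) : ↥(adelicUnipotent F E c 2)) : (quasiSplit F E c 2).Adelic) * k) ∂μ := by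
      rw [hreal, ← mul_assoc, inv_mul_cancel₀ hc₀', one_mul]
    rw [heq]
    exact mul_le_mul_of_nonneg_left ((h𝓔N k hk).trans (le_max_left _ _)) (inv_nonneg.2 (NNReal.coe_nonneg c₀))
  · -- the fibre bound (§2)
    obtain ⟨hcd, henv⟩ := hφarch k hk b
    exact norm_integral_fibre_le_of_contDiff F μ₁ hC0 hC hcd (hfib k hk b) (fun j hj s => henv j hj s) y

end Head

end Summit.HodgeConjecture.HodgeConjecture.Cruxes.H413.K2E1FlatSectionLineRestrictionArchU2

end
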